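import Summits.CriticalPhenomena.PercolationContinuityZ3.Theorems.Transplant.SiteWorldDefs
import Summits.CriticalPhenomena.PercolationContinuityZ3.Theorems.Transplant.SiteCovTransferSet
import HarnessLib

/-!
# SITE percolation: LEMMA Φ of the site conditioned slack hierarchy — the residual functional of the world-wise unfolding is
# nonnegative and increasing (WP6 piece of P1-SITE-Z3 §12/§15; site twin of `Theorems/PercNearOneGluingNoHeavyLowerTailCSHPhi.lean`)

builds on p205010 (kernel theorem, internal audit signed; external expert review pending).

Bond: "off `K`" deletes the PAIRS meeting `K`, and `cut_X` the pairs meeting the open vertex cluster of `X`.  SITE (conventions of §15): "off `D`"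
deletes the VERTEX set `D` (in the unfolding, `D = SiteBHK.deadOf {d} K` = the decoy, its cluster value and its vertex boundary), and the explored
set of `X` in a configuration `ω'` is its dead set `SiteCSH.worldDead Γ X ω'` (p211418).  The residual integrand
  `I_D(ω) = 1{s ↮ X in ω ∖ D} · ( g(C_s(ω ∖ worldDead_X(ω ∖ D))) − g(C_s(ω ∖ D)) )`
("explore the cluster of `X` off `D`; compare the cluster of `s` outside the explored dead set — which may use `D` — with the cluster of `s`
off `D`") is pointwise `≥ 0` and pointwise increasing in `D` for monotone `g`; hence `Φ(D) = ∫ I_D dμ_q ≥ 0` is increasing — an admissible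
functional for the lower-level conditioned covariance transfers.
Definitions + proofs (`--supports stmt-CriticalPhenomena-4575 --as helper`); no named facts, no sorries.
[cite: VandenbergHaggstromKahn2005, §1 pp. 3–5 (clusters in `G − Z`; induced model)] [cite: KozmaNitzan2024, Conj. 4 (p. 32)]
-/

noncomputable section

namespace Summit.CriticalPhenomena.PercolationContinuityZ3.Theorems.Transplant

namespace SiteCSH

open MeasureTheory Set
open Literature.Probability.LatticeModels (prodBernoulli)
open Literature.Probability.Percolation
open SiteGen (siteCluster_mono' siteCluster_eq_of_mem)
open scoped Classical

variable {V : Type*} {Γ : SimpleGraph V}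

/-- The dead set of `X` grows with the configuration. [folklore] -/
theorem worldDead_mono (X : Set V) {ω ω' : Set V} (h : ω ⊆ ω') : worldDead Γ X ω ⊆ worldDead Γ X ω' := by
  rintro u (hu | ⟨y, hy, hu | ⟨z, hz, huz⟩⟩)
  · exact Or.inl hu
  · exact Or.inr ⟨y, hy, Or.inl (siteCluster_mono' Γ y h hu)⟩
  · exact Or.inr ⟨y, hy, Or.inr ⟨z, siteCluster_mono' Γ y h hz, huz⟩⟩

variable (Γ)

/-- **The integrand of site Lemma Φ**: `I_D(ω) = 1{s ↮ X in ω ∖ D} · ( g(C_s(ω ∖ worldDead_X(ω ∖ D))) − g(C_s(ω ∖ D)) )`.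
[cite: VandenbergHaggstromKahn2005, §1 p. 4] -/
def phiIntegrand (s : V) (X D : Set V) (g : Set V → ℝ) (ω : Set V) : ℝ :=
  if (∀ x ∈ X, x ∉ siteCluster Γ (ω \ D) s) then
    g (siteCluster Γ (ω \ worldDead Γ X (ω \ D)) s) - g (siteCluster Γ (ω \ D) s)
  else 0

variable {Γ}

/-- On `{s ↮ X in ω ∖ D}` the cluster of `s` off `D` avoids the dead set of `X` (off `D`), hence lies in the cluster of `s` outside that
dead set. [folklore] -/
theorem siteCluster_off_subset (s : V) (X D : Set V) (ω : Set V) (havoid : ∀ x ∈ X, x ∉ siteCluster Γ (ω \ D) s) :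
    siteCluster Γ (ω \ D) s ⊆ siteCluster Γ (ω \ worldDead Γ X (ω \ D)) s := by
  set ω' := ω \ D with hω'
  -- the cluster of `s` off `D` misses the dead set of `X` off `D`
  have hC : siteCluster Γ ω' s ⊆ ω \ worldDead Γ X ω' := by
    intro y hy
    refine ⟨hy.2.1.1, ?_⟩
    rintro (hyX | ⟨x, hx, hyx | ⟨z, hz, hyz⟩⟩)
    · exact havoid y hyX hy
    · -- `y ∈ C_x` and `y ∈ C_s`: then `x ∈ C_s`
      refine havoid x hx ?_
      rw [siteCluster_eq_of_mem Γ hy, ← siteCluster_eq_of_mem Γ hyx]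
      exact (mem_siteCluster_self_iff Γ ω' x).2 hyx.1
    · -- `y ~ z`, `z ∈ C_x`, `y` open off `D`: then `x ↔ y ↔ s`
      refine havoid x hx ?_
      have hyCx : y ∈ siteCluster Γ ω' x :=
        ⟨hz.1, hy.2.1, hz.2.2.trans (SimpleGraph.Adj.reachable ((siteOpenGraph_adj Γ ω' z y).2 ⟨hyz.symm, hz.2.1, hy.2.1⟩))⟩
      rw [siteCluster_eq_of_mem Γ hy, ← siteCluster_eq_of_mem Γ hyCx]
      exact (mem_siteCluster_self_iff Γ ω' x).2 hz.1
  intro y hy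
  by_cases hs : s ∈ ω'
  · have hreach := reachable_siteOpenGraph_siteCluster Γ hs hy.2.2
    have hsC : s ∈ siteCluster Γ ω' s := (mem_siteCluster_self_iff Γ ω' s).2 hs
    refine ⟨hC hsC, hC hy, hreach.mono fun a b hab => ?_⟩
    rw [siteOpenGraph_adj] at hab ⊢
    exact ⟨hab.1, hC hab.2.1, hC hab.2.2⟩
  · exact absurd hy.1 hs

/-- **Site Lemma Φ, pointwise nonnegativity.** [folklore] -/
theorem phiIntegrand_nonneg (s : V) (X D : Set V) {g : Set V → ℝ} (hg : Monotone g) (ω : Set V) :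
    0 ≤ phiIntegrand Γ s X D g ω := by
  unfold phiIntegrand
  split_ifs with havoid
  · exact sub_nonneg.2 (hg (siteCluster_off_subset s X D ω havoid))
  · exact le_rfl

/-- **Site Lemma Φ, pointwise monotonicity in the deleted set**: `D ⊆ D' ⟹ I_D(ω) ≤ I_{D'}(ω)`. [folklore] -/
theorem phiIntegrand_mono (s : V) (X : Set V) {D D' : Set V} (hDD' : D ⊆ D') {g : Set V → ℝ} (hg : Monotone g)
    (ω : Set V) : phiIntegrand Γ s X D g ω ≤ phiIntegrand Γ s X D' g ω := by
  have hsub : ω \ D' ⊆ ω \ D := sdiff_subset_sdiff_right hDD'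
  by_cases havoid : ∀ x ∈ X, x ∉ siteCluster Γ (ω \ D) s
  · have havoid' : ∀ x ∈ X, x ∉ siteCluster Γ (ω \ D') s :=
      fun x hx h => havoid x hx (siteCluster_mono' Γ s hsub h)
    unfold phiIntegrand
    rw [if_pos havoid, if_pos havoid']
    have h1 : g (siteCluster Γ (ω \ worldDead Γ X (ω \ D)) s) ≤ g (siteCluster Γ (ω \ worldDead Γ X (ω \ D')) s) :=
      hg (siteCluster_mono' Γ s (sdiff_subset_sdiff_right (worldDead_mono X hsub)))
    have h2 : g (siteCluster Γ (ω \ D') s) ≤ g (siteCluster Γ (ω \ D) s) := hg (siteCluster_mono' Γ s hsub)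
    linarith
  · have h0 : phiIntegrand Γ s X D g ω = 0 := by
      unfold phiIntegrand
      rw [if_neg havoid]
    rw [h0]
    exact phiIntegrand_nonneg s X D' hg ω

variable (Γ) in
/-- **The residual functional `Φ` of the site world-wise unfolding**: `Φ(D) = ∫ I_D dμ_q`. [cite: VandenbergHaggstromKahn2005, §1 p. 4] -/
def phiFun (q : V → unitInterval) (s : V) (X : Set V) (g : Set V → ℝ) (D : Set V) : ℝ :=
  ∫ ω, phiIntegrand Γ s X D g ω ∂(prodBernoulli q)

/-- **Site Lemma Φ**: `Φ ≥ 0`. [folklore] -/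
theorem phiFun_nonneg (q : V → unitInterval) (s : V) (X : Set V) {g : Set V → ℝ} (hg : Monotone g) (D : Set V) :
    0 ≤ phiFun Γ q s X g D :=
  integral_nonneg fun ω => phiIntegrand_nonneg s X D hg ω

/-- **Site Lemma Φ**: `Φ` is increasing in the deleted set. [folklore] -/
theorem phiFun_mono [Fintype V] (q : V → unitInterval) (s : V) (X : Set V) {g : Set V → ℝ} (hg : Monotone g) :
    Monotone (phiFun Γ q s X g) := by
  intro D D' hDD'
  exact integral_mono (Integrable.of_finite) (Integrable.of_finite) fun ω => phiIntegrand_mono s X hDD' hg ω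

end SiteCSH

end Summit.CriticalPhenomena.PercolationContinuityZ3.Theorems.Transplant
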